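import Literature.AlgebraicGeometry.Frobenioids.ArithmeticFrobenioidThm64ivGaloisConjugate
import Literature.AlgebraicGeometry.Frobenioids.ArithmeticFrobenioidThm64ivFiniteEquivariance
import Literature.NumberTheory.NumberFields.PrincipalDivisorTransportPrimes
import Literature.NumberTheory.NumberFields.DecompositionGroupsPrescribed
import HarnessLib

/-!
# Frobenioids I, Theorem 6.4 (iv): the compatibility clause `F₁ ≅ F₂` AT THE CONSTRUCTIONS — in general
# (GAP-LEDGER G-L1t3-1 #2 closed: no hypothesis on `F₁`)

Mochizuki, *The geometry of Frobenioids I: the general theory*, Kyushu J. Math. **62** (2008) 293–400, §6,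
Thm. 6.4 (iv) p. 115 l. 23–29: «If, moreover, there exists a finite extension `L₁ ⊆ F̃₁` of `F₁` which is Galois
over `ℚ`, then the corresponding [i.e., via the equivalence `D₁ ⥲ D₂` induced by `Ψ`] finite extension `L₂ ⊆ F̃₂`
of `F₂` is isomorphic to `L₁` in a fashion that is compatible with an isomorphism `F₁ ⥲ F₂`.» — the printed proof
(p. 116) stops at `L₁ = L₂` [cite: MochizukiFrdI2008, Thm. 6.4 (iv) p.115].

PROOF-ONLY file (cell abc-iut, layer L1, seat abc-iut-L1-d3 gen 4; GAP-LEDGER G-L1t3-1 #2 — the «general case»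
supplement to abc-iut-w4-d090's row; 0 definitions, no named facts).  **`Thm64iv_arith_compat_general`**: for every
equivalence `Ψ : C_{K₁/F₁} ⥲ C_{K₂/F₂}` of THE arithmetic Frobenioids with its Cor. 4.11 (iv) datum
`(Ψ^Base, Ψ^Φ, η, hdiv)` and every `X = Spec L₁` with `L₁` Galois over `ℚ`, there are `e : L₁ ⥲ L₂ := (Ψ^Base X).L`
and `e₀ : F₁ ⥲ F₂` with `e ∘ (F₁ → L₁) = (F₂ → L₂) ∘ e₀` — for ARBITRARY number fields `F₁` (no Galois / solitary
/ Sylow / degree hypothesis).  Mechanism (own argument, beyond print; all inputs kernel theorems of the tree):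
with `e₁ : L₁ ≅ L₂` (abc-iut-L1-d7) and the archimedean transport `π_∞`, `(π_∞ v) ∘ e₁ = s • v` for some
`s ∈ Gal(L₁/ℚ)` (`arith_archTransport_galois`); for `h ∈ Aut(X)` with `Ψ^Base(h)` read on `L₁` as `α_h`, the element
`z_h := s⁻¹ α_h s h⁻¹` fixes every infinite place, so `α_h = s z_h h s⁻¹` with `z_h = 1` (always, when `L₁` is not CM)
or `z_h = c` = the complex conjugation of the CM field `L₁` (central, `c² = 1`); in the latter case `c ∈ ⟨h⟩` —
the finite part of the transport moves primes inside their `c`-orbits (`exists_maximalIdeal_rho_eq_smul`) and is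
`h ↦ h c`-twisted equivariant (`arith_finitePlaceTransport_equivariant`), which at a prime with decomposition group
exactly `⟨h⟩` (Chebotarev, `exists_stabilizer_eq_zpowers`, abc-iut-w4-d090) forces `c ∈ ⟨h⟩`
(`mem_zpowers_of_twisted_equivariant_at`); hence `z_h` fixes `F₁`, `e := e₁ ∘ s` intertwines `Gal(L₁/F₁)` with
`Gal(L₂/F₂)` in both directions, and `exists_baseRingEquiv_of_conj` gives `e₀`.
Nothing here bears on, or takes a side on, [IUTchIII] Cor. 3.12.
-/

noncomputable section

namespace Literature.AlgebraicGeometry.Frobenioids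

open CategoryTheory Opposite NumberField NumberField.InfinitePlace ArithPullback
open Literature.NumberTheory.NumberFields

open scoped Pointwise

/-! ### Small helpers: involutions fixing all infinite places; restricting to `F`-automorphisms -/

section Helpers

variable {L : Type} [Field L] [NumberField L]

/-- Two non-trivial elements of `Gal(L/ℚ)` fixing the same infinite place are equal (the stabiliser has at most
two elements). [cite: MochizukiFrdI2008, Thm. 6.4 (iv) p.115] -/
theorem eq_of_smul_infinitePlace_eq {g g' : L ≃ₐ[ℚ] L} {v : InfinitePlace L} (hg : g • v = v) (hg' : g' • v = v)
    (h1 : g ≠ 1) (h1' : g' ≠ 1) : g = g' := by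
  rw [← mk_embedding v] at hg hg'
  have h2 := (mem_stabilizer_mk_iff (k := ℚ) v.embedding g).mp hg
  have h3 := (mem_stabilizer_mk_iff (k := ℚ) v.embedding g').mp hg'
  rcases h2 with h2 | h2
  · exact absurd h2 h1
  rcases h3 with h3 | h3
  · exact absurd h3 h1'
  exact h2.ext h3

/-- An element of `Gal(L/ℚ)` fixing `F` pointwise, as an `F`-algebra automorphism.
[cite: MochizukiFrdI2008, Thm. 6.4 (iv) p.115] -/
theorem exists_algEquiv_restrict {F : Type} [Field F] [Algebra F L] (g : L ≃ₐ[ℚ] L)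
    (hg : ∀ a : F, g (algebraMap F L a) = algebraMap F L a) : ∃ τ : L ≃ₐ[F] L, ∀ x, τ x = g x :=
  ⟨{ g.toRingEquiv with commutes' := hg }, fun _ => rfl⟩

end Helpers

/-! ### The clause, for every `F₁` -/

section Arith

variable {F₁ : Type} [Field F₁] [NumberField F₁] {K₁ : Type} [Field K₁] [Algebra F₁ K₁] [IsGalois F₁ K₁]
variable {F₂ : Type} [Field F₂] [NumberField F₂] {K₂ : Type} [Field K₂] [Algebra F₂ K₂] [IsGalois F₂ K₂]

/-- **[FrdI] Thm. 6.4 (iv), the compatibility clause AT THE CONSTRUCTIONS, for EVERY `F₁`**: for an equivalence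
`Ψ : C_{K₁/F₁} ⥲ C_{K₂/F₂}` of THE arithmetic Frobenioids with Cor. 4.11 (iv) datum `(Ψ^Base, Ψ^Φ, η)` and
`X = Spec L₁` with `L₁` Galois over `ℚ`, the field `L₂ := (Ψ^Base X).L` is isomorphic to `L₁` compatibly with an
isomorphism `F₁ ⥲ F₂`. [cite: MochizukiFrdI2008, Thm. 6.4 (iv) p.115] -/
theorem Thm64iv_arith_compat_general (Ψ : arithFrobenioid F₁ K₁ ≌ arithFrobenioid F₂ K₂)
    {ΨBase : FinSubextCat F₁ K₁ ⥤ FinSubextCat F₂ K₂} [ΨBase.IsEquivalence]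
    (E : PreFrobenioidData.DivisorMonoidIsoOverBase (arithFrobenioidOps F₁ K₁) (arithFrobenioidOps F₂ K₂) ΨBase)
    (η : Ψ.functor ⋙ (arithFrobenioidOps F₂ K₂).base ≅ (arithFrobenioidOps F₁ K₁).base ⋙ ΨBase)
    (hdiv : ∀ ⦃A B : arithFrobenioid F₁ K₁⦄ (φ : A ⟶ B),
      (arithFrobenioidOps F₂ K₂).div (Ψ.functor.map φ) =
        (arithFrobenioidOps F₂ K₂).pull (η.hom.app A)
          (E.iso ((arithFrobenioidOps F₁ K₁).base.obj A) ((arithFrobenioidOps F₁ K₁).div φ)))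
    (X : FinSubextCat F₁ K₁) (hX : IsGalois ℚ X.L) :
    ∃ (e : X.L ≃+* (ΨBase.obj X).L) (e₀ : F₁ ≃+* F₂),
      ∀ a : F₁, e (algebraMap F₁ X.L a) = algebraMap F₂ (ΨBase.obj X).L (e₀ a) := by
  classical
  haveI := hX
  -- (0) the field isomorphism `e₁ : L₁ ≅ L₂` (abc-iut-L1-d7) and the Galois structures
  obtain ⟨e₁⟩ := Thm64iv_arith_fieldIso Ψ E η hdiv X hX
  haveI : IsScalarTower ℚ F₁ X.L :=
    IsScalarTower.of_algebraMap_eq fun q => ((algebraMap F₁ X.L).map_rat_algebraMap q).symm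
  haveI : IsScalarTower ℚ F₂ (ΨBase.obj X).L :=
    IsScalarTower.of_algebraMap_eq fun q => ((algebraMap F₂ (ΨBase.obj X).L).map_rat_algebraMap q).symm
  let e₁ℚ : X.L ≃ₐ[ℚ] (ΨBase.obj X).L :=
    AlgEquiv.ofRingEquiv (f := e₁) fun q => (e₁ : X.L →+* (ΨBase.obj X).L).map_rat_algebraMap q
  haveI : IsGalois ℚ (ΨBase.obj X).L := IsGalois.of_algEquiv e₁ℚ
  haveI : IsGalois F₁ X.L := IsGalois.tower_top_of_isGalois ℚ F₁ X.L
  haveI : IsGalois F₂ (ΨBase.obj X).L := IsGalois.tower_top_of_isGalois ℚ F₂ (ΨBase.obj X).L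
  -- (1) the transport structure of `Ψ^Φ_X` and its reading `Γ` on `L₁` through `e₁`
  obtain ⟨π, πi, eG, hπ, -, hequiv, -, hfin, harch, hprinc⟩ := arith_archTransport Ψ E η hdiv X hX e₁
  let σe : (ΨBase.obj X).L →+* X.L := (e₁.symm : (ΨBase.obj X).L →+* X.L)
  let Γ : ArithDivisor X.L →+ ArithDivisor X.L := (ArithDivisor.pullback σe).comp eG
  have heσ : ((e₁ : X.L →+* (ΨBase.obj X).L).comp σe) = RingHom.id (ΨBase.obj X).L := by ext x; simp [σe]
  have hσe : (σe.comp (e₁ : X.L →+* (ΨBase.obj X).L)) = RingHom.id X.L := by ext x; simp [σe]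
  have hunder : ∀ w : FinitePlace (ΨBase.obj X).L,
      underPlace σe (underPlace (e₁ : X.L →+* (ΨBase.obj X).L) w) = w := fun w => by
    rw [← underPlace_comp, heσ, underPlace_id]
  have hunder' : ∀ w : FinitePlace X.L,
      underPlace (e₁ : X.L →+* (ΨBase.obj X).L) (underPlace σe w) = w := fun w => by
    rw [← underPlace_comp, hσe, underPlace_id]
  have hram : ∀ w : FinitePlace X.L, ramIdxPlace σe w = 1 := fun w => by
    have h1 := ramIdxPlace_comp (e₁ : X.L →+* (ΨBase.obj X).L) σe w
    rw [hσe, ramIdxPlace_id] at h1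
    exact Nat.eq_one_of_mul_eq_one_left h1.symm
  let ρf : FinitePlace X.L ≃ FinitePlace X.L :=
    { toFun := fun w => underPlace (e₁ : X.L →+* (ΨBase.obj X).L) (π w)
      invFun := fun w => π.symm (underPlace σe w)
      left_inv := fun w => by simp [hunder]
      right_inv := fun w => by simp [hunder'] }
  let ρi : InfinitePlace X.L ≃ InfinitePlace X.L :=
    { toFun := fun v => (πi v).comap (e₁ : X.L →+* (ΨBase.obj X).L)
      invFun := fun v => πi.symm (v.comap σe)
      left_inv := fun v => by
        simp only
        rw [← InfinitePlace.comap_comp, heσ, InfinitePlace.comap_id, Equiv.symm_apply_apply]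
      right_inv := fun v => by
        simp only
        rw [Equiv.apply_symm_apply, ← InfinitePlace.comap_comp, hσe, InfinitePlace.comap_id] }
  have hρf : ∀ w, ρf w = underPlace (e₁ : X.L →+* (ΨBase.obj X).L) (π w) := fun _ => rfl
  have hΓfin : ∀ (d : ArithDivisor X.L) (w : FinitePlace X.L), (Γ d).1 (ρf w) = d.1 w := fun d w => by
    change (ArithDivisor.pullback σe (eG d)).1 (underPlace (e₁ : X.L →+* (ΨBase.obj X).L) (π w)) = _
    rw [ArithDivisor.pullback_fst, hram, hunder, hfin, Nat.cast_one, one_mul]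
  have hΓarch : ∀ (d : ArithDivisor X.L) (v : InfinitePlace X.L), (Γ d).2 (ρi v) = d.2 v := fun d v => by
    change (ArithDivisor.pullback σe (eG d)).2 ((πi v).comap (e₁ : X.L →+* (ΨBase.obj X).L)) = _
    rw [ArithDivisor.pullback_snd, ← InfinitePlace.comap_comp, heσ, InfinitePlace.comap_id, harch]
  have hΓprinc : ∀ x : (X.L)ˣ, ∃ y : (X.L)ˣ, Γ (principalArithDivisor X.L x) = principalArithDivisor X.L y := by
    intro x
    obtain ⟨y, hy⟩ := hprinc x
    refine ⟨Units.map (σe : (ΨBase.obj X).L →* X.L) y, ?_⟩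
    change ArithDivisor.pullback σe (eG (principalArithDivisor X.L x)) = _
    rw [hy, ArithDivisor.pullback_principalArithDivisor]
  obtain ⟨s, hs⟩ := exists_algEquiv_forall_eq_smul Γ ρf ρi hΓfin hΓarch hΓprinc
  have hs' : ∀ v : InfinitePlace X.L, (πi v).comap (e₁ : X.L →+* (ΨBase.obj X).L) = s • v := hs
  -- (2) for every `h ∈ Aut(X)`: `σ h` (= `h` on `L₁`), `σ' h` (= `Ψ^Base h` on `L₂`), `α h := e₁⁻¹ σ' e₁`
  choose σ hσ using fun h : X ⟶ X => exists_algEquiv_rat_eq (F := F₁) h.toAlgHom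
  choose σ' hσ' using fun h : X ⟶ X => exists_algEquiv_rat_eq (F := F₂) (ΨBase.map h).toAlgHom
  let αr : (X ⟶ X) → (X.L ≃+* X.L) := fun h => e₁.trans ((σ' h).toRingEquiv.trans e₁.symm)
  let α : (X ⟶ X) → (X.L ≃ₐ[ℚ] X.L) := fun h =>
    AlgEquiv.ofRingEquiv (f := αr h) fun q => (αr h : X.L →+* X.L).map_rat_algebraMap q
  have hα : ∀ h x, α h x = e₁.symm (σ' h (e₁ x)) := fun _ _ => rfl
  have hα' : ∀ h y, e₁ (α h y) = (ΨBase.map h).toAlgHom (e₁ y) := fun h y => by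
    rw [hα, RingEquiv.apply_symm_apply, hσ']
  have hcomp : ∀ h, (((ΨBase.map h).toAlgHom : (ΨBase.obj X).L →+* (ΨBase.obj X).L).comp
      (e₁ : X.L →+* (ΨBase.obj X).L)) = (e₁ : X.L →+* (ΨBase.obj X).L).comp (α h : X.L →+* X.L) := fun h => by
    refine RingHom.ext fun x => ?_
    simp only [RingHom.coe_comp, RingHom.coe_coe, Function.comp_apply]
    exact (hα' h x).symm
  have hσcoe : ∀ h, ((σ h : X.L ≃ₐ[ℚ] X.L) : X.L →+* X.L) = (h.toAlgHom : X.L →+* X.L) := fun h =>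
    RingHom.ext fun x => hσ h x
  -- the archimedean equivariance: `(s (σ h)⁻¹) • v = ((α h)⁻¹ s) • v`
  have hact : ∀ (h : X ⟶ X) (v : InfinitePlace X.L), (s * (σ h)⁻¹) • v = ((α h)⁻¹ * s) • v := by
    intro h v
    have h1 := hequiv h v
    have h2 := hs' (v.comap (h.toAlgHom : X.L →+* X.L))
    rw [h1, ← InfinitePlace.comap_comp, hcomp, InfinitePlace.comap_comp, hs' v] at h2
    have hvσ : v.comap (h.toAlgHom : X.L →+* X.L) = (σ h)⁻¹ • v := by
      rw [smul_eq_comap, AlgEquiv.aut_inv, AlgEquiv.symm_symm, hσcoe]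
    have hαv : (s • v).comap (α h : X.L →+* X.L) = (α h)⁻¹ • (s • v) := by
      rw [smul_eq_comap ((α h)⁻¹), AlgEquiv.aut_inv, AlgEquiv.symm_symm]
    rw [hvσ, hαv, ← mul_smul, ← mul_smul] at h2
    exact h2.symm
  -- `z h := s⁻¹ (α h) s (σ h)⁻¹` fixes every infinite place; `α h = s (z h) (σ h) s⁻¹`
  let z : (X ⟶ X) → (X.L ≃ₐ[ℚ] X.L) := fun h => s⁻¹ * α h * s * (σ h)⁻¹
  have hzfix : ∀ h (v : InfinitePlace X.L), z h • v = v := fun h v => by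
    have e1 : z h = (s⁻¹ * α h) * (s * (σ h)⁻¹) := by simp only [z]; group
    have e2 : s⁻¹ * α h * ((α h)⁻¹ * s) = 1 := by group
    rw [e1, mul_smul, hact h v, ← mul_smul, e2, one_smul]
  have hαz : ∀ h, α h = s * z h * σ h * s⁻¹ := fun h => by
    change α h = s * (s⁻¹ * α h * s * (σ h)⁻¹) * σ h * s⁻¹
    group
  -- if `z h ≠ 1`: it is THE non-trivial element fixing all infinite places, central, an involution
  have huniq : ∀ h, z h ≠ 1 → ∀ g : X.L ≃ₐ[ℚ] X.L, (∀ v : InfinitePlace X.L, g • v = v) → g = 1 ∨ g = z h := by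
    intro h hz g hg
    by_cases hg1 : g = 1
    · exact Or.inl hg1
    · obtain ⟨v₀⟩ := (inferInstance : Nonempty (InfinitePlace X.L))
      exact Or.inr (eq_of_smul_infinitePlace_eq (hg v₀) (hzfix h v₀) hg1 hz)
  have hcentral : ∀ h, z h ≠ 1 → ∀ g : X.L ≃ₐ[ℚ] X.L, g * z h = z h * g := by
    intro h hz g
    have hfix : ∀ v : InfinitePlace X.L, (g * z h * g⁻¹) • v = v := fun v => by
      rw [mul_smul, mul_smul, hzfix h, ← mul_smul, mul_inv_cancel, one_smul]
    rcases huniq h hz _ hfix with h1 | h1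
    · exfalso; apply hz
      calc z h = g⁻¹ * (g * z h * g⁻¹) * g := by group
        _ = 1 := by rw [h1]; group
    · calc g * z h = (g * z h * g⁻¹) * g := by group
        _ = z h * g := by rw [h1]
  have hinvol : ∀ h, z h ≠ 1 → z h * z h = 1 := by
    intro h hz
    have hfix : ∀ v : InfinitePlace X.L, (z h * z h) • v = v := fun v => by rw [mul_smul, hzfix h, hzfix h]
    rcases huniq h hz _ hfix with h1 | h1
    · exact h1
    · exfalso; apply hz
      calc z h = (z h)⁻¹ * (z h * z h) := by group
        _ = 1 := by rw [h1, inv_mul_cancel]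
  -- (3) the CM step: if `z h ≠ 1` then `z h ∈ ⟨σ h⟩`
  have hzpow : ∀ h, z h ≠ 1 → z h ∈ Subgroup.zpowers (σ h) := by
    intro h hz
    obtain ⟨v₀⟩ := (inferInstance : Nonempty (InfinitePlace X.L))
    obtain ⟨q, Q, -, -, hQ, -, hstabQ⟩ := exists_stabilizer_eq_zpowers (F := ℚ) ((σ h)⁻¹)
    haveI := q.isMaximal
    have hQne : Q ≠ ⊥ := Ideal.ne_bot_of_mem_primesOver q.ne_bot hQ
    haveI : Q.IsPrime := hQ.1
    -- the transport read on ideals, normalised by `s⁻¹`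
    let P : Ideal (𝓞 X.L) → Ideal (𝓞 X.L) := fun I =>
      if hI : I.IsPrime ∧ I ≠ ⊥ then s⁻¹ • (ρf (FinitePlace.mk ⟨I, hI.1, hI.2⟩)).maximalIdeal.asIdeal else I
    have hP : ∀ 𝔔 : IsDedekindDomain.HeightOneSpectrum (𝓞 X.L),
        P 𝔔.asIdeal = s⁻¹ • (ρf (FinitePlace.mk 𝔔)).maximalIdeal.asIdeal := fun 𝔔 => by
      simp only [P, dif_pos (show 𝔔.asIdeal.IsPrime ∧ 𝔔.asIdeal ≠ ⊥ from ⟨𝔔.isPrime, 𝔔.ne_bot⟩)]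
    -- where the primes go: `P 𝔔 = (z₁ z₂) • 𝔔` with `z_i ∈ Stab(v₀) ⊆ {1, z h}`
    have hstabv₀ : ∀ g : X.L ≃ₐ[ℚ] X.L, g • v₀ = v₀ → g = 1 ∨ g = z h := fun g hg => by
      by_cases hg1 : g = 1
      · exact Or.inl hg1
      · exact Or.inr (eq_of_smul_infinitePlace_eq hg (hzfix h v₀) hg1 hz)
    have hPc : ∀ 𝔔 : IsDedekindDomain.HeightOneSpectrum (𝓞 X.L),
        P 𝔔.asIdeal = 𝔔.asIdeal ∨ P 𝔔.asIdeal = z h • 𝔔.asIdeal := fun 𝔔 => by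
      obtain ⟨z₁, z₂, hz₁, hz₂, h𝔔⟩ :=
        exists_maximalIdeal_rho_eq_smul Γ ρf ρi hΓfin hΓarch hΓprinc hs v₀ 𝔔
      rw [hP, h𝔔, ← mul_smul, ← mul_assoc, ← mul_assoc, inv_mul_cancel, one_mul]
      rcases hstabv₀ z₁ hz₁ with h₁ | h₁ <;> rcases hstabv₀ z₂ hz₂ with h₂ | h₂
      · left; rw [h₁, h₂, one_mul, one_smul]
      · right; rw [h₁, h₂, one_mul]
      · right; rw [h₁, h₂, mul_one]
      · left; rw [h₁, h₂, hinvol h hz, one_smul]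
    -- twisted equivariance at `Q`: `P ((σ h)⁻¹ • Q) = ((σ h)⁻¹ * z h) • P Q`
    set 𝔔 : IsDedekindDomain.HeightOneSpectrum (𝓞 X.L) := ⟨Q, hQ.1, hQne⟩ with h𝔔def
    have hσQ : ((σ h)⁻¹ • Q).IsPrime ∧ (σ h)⁻¹ • Q ≠ ⊥ := by
      refine ⟨?_, fun h0 => hQne ?_⟩
      · rw [Ideal.pointwise_smul_def]
        exact Ideal.map_isPrime_of_equiv (MulSemiringAction.toRingEquiv _ (𝓞 X.L) (σ h)⁻¹)
      have := congrArg (fun I => σ h • I) h0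
      simpa only [smul_inv_smul, Ideal.smul_bot] using this
    set 𝔔' : IsDedekindDomain.HeightOneSpectrum (𝓞 X.L) := ⟨(σ h)⁻¹ • Q, hσQ.1, hσQ.2⟩ with h𝔔'def
    have hplace : FinitePlace.mk 𝔔' = underPlace ((σ h : X.L ≃ₐ[ℚ] X.L) : X.L →+* X.L) (FinitePlace.mk 𝔔) := by
      rw [← FinitePlace.maximalIdeal_inj, FinitePlace.maximalIdeal_mk]
      apply IsDedekindDomain.HeightOneSpectrum.ext
      rw [asIdeal_maximalIdeal_underPlace_algEquiv, FinitePlace.maximalIdeal_mk]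
    have hequivQ : ρf (underPlace ((σ h : X.L ≃ₐ[ℚ] X.L) : X.L →+* X.L) (FinitePlace.mk 𝔔)) =
        underPlace ((α h : X.L ≃ₐ[ℚ] X.L) : X.L →+* X.L) (ρf (FinitePlace.mk 𝔔)) := by
      rw [hρf, hρf, hσcoe, arith_finitePlaceTransport_equivariant E X π hπ h, ← underPlace_comp, hcomp,
        underPlace_comp]
    have hPh : P ((σ h)⁻¹ • Q) = ((σ h)⁻¹ * z h) • P Q := by
      have e1 : P ((σ h)⁻¹ • Q) = s⁻¹ • (ρf (FinitePlace.mk 𝔔')).maximalIdeal.asIdeal := hP 𝔔'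
      have e2 : P Q = s⁻¹ • (ρf (FinitePlace.mk 𝔔)).maximalIdeal.asIdeal := hP 𝔔
      rw [e1, hplace, hequivQ, asIdeal_maximalIdeal_underPlace_algEquiv, ← mul_smul]
      rw [e2, ← mul_smul]
      congr 1
      rw [hαz h]
      have hzinv : (z h)⁻¹ = z h := inv_eq_of_mul_eq_one_right (hinvol h hz)
      calc s⁻¹ * (s * z h * σ h * s⁻¹)⁻¹ = (σ h)⁻¹ * (z h)⁻¹ * s⁻¹ := by group
        _ = (σ h)⁻¹ * z h * s⁻¹ := by rw [hzinv]
    have hcomm : Commute (z h) ((σ h)⁻¹) := (hcentral h hz (σ h)⁻¹).symm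
    have hmem := mem_zpowers_of_twisted_equivariant_at (F := ℚ) hcomm P hstabQ (hPc 𝔔) hPh
    rwa [Subgroup.zpowers_inv] at hmem
  -- hence `z h` fixes `F₁` pointwise
  have hzF : ∀ h (a : F₁), z h (algebraMap F₁ X.L a) = algebraMap F₁ X.L a := by
    intro h a
    by_cases hz : z h = 1
    · rw [hz, AlgEquiv.one_apply]
    · have hsub : Subgroup.zpowers (σ h) ≤ MulAction.stabilizer (X.L ≃ₐ[ℚ] X.L) (algebraMap F₁ X.L a) := by
        rw [Subgroup.zpowers_le, MulAction.mem_stabilizer_iff, AlgEquiv.smul_def, hσ, AlgHom.commutes]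
      exact hsub (hzpow h hz)
  -- (4) `e := e₁ ∘ s` intertwines the two Galois groups in both directions
  let e : X.L ≃+* (ΨBase.obj X).L := s.toRingEquiv.trans e₁
  have he : ∀ x, e x = e₁ (s x) := fun x => rfl
  have hkey : ∀ (h : X ⟶ X) (x : X.L), (ΨBase.map h).toAlgHom (e₁ (s x)) = e₁ (s (z h (σ h x))) := by
    intro h x
    rw [← hα', hαz]
    simp only [AlgEquiv.mul_apply, AlgEquiv.aut_inv, AlgEquiv.symm_apply_apply]
  refine ⟨e, exists_baseRingEquiv_of_conj e (fun τ₂ => ?_) (fun τ₁ => ?_)⟩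
  · -- `τ₂ = Ψ^Base(h)`: `τ₂ ∘ e = e ∘ (z h ∘ σ h)`, an `F₁`-automorphism
    let h : X ⟶ X := ΨBase.preimage (FinSubextCat.Hom.mk τ₂.toAlgHom : ΨBase.obj X ⟶ ΨBase.obj X)
    have hh : (ΨBase.map h).toAlgHom = τ₂.toAlgHom := by rw [ΨBase.map_preimage]
    obtain ⟨τ₁, hτ₁⟩ := exists_algEquiv_restrict (F := F₁) (z h * σ h) fun a => by
      rw [AlgEquiv.mul_apply, hσ, AlgHom.commutes, hzF]
    refine ⟨τ₁, fun x => ?_⟩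
    rw [he, he, hτ₁, AlgEquiv.mul_apply, ← hkey h x, hh]
    rfl
  · -- `τ₁ = h`: `Ψ^Base(h) ∘ e = e ∘ (z h ∘ τ₁)`; cancel `z h` with `Ψ^Base(h_z)`, `h_z := z h ∈ Aut(X)`
    let h : X ⟶ X := FinSubextCat.Hom.mk τ₁.toAlgHom
    have hσh : ∀ x, σ h x = τ₁ x := fun x => hσ h x
    by_cases hz : z h = 1
    · obtain ⟨τ₂, hτ₂⟩ := exists_algEquiv_rat_eq (F := F₂) (ΨBase.map h).toAlgHom
      refine ⟨AlgEquiv.ofRingEquiv (f := (σ' h).toRingEquiv) fun b => ?_, fun x => ?_⟩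
      · change σ' h (algebraMap F₂ _ b) = _
        rw [hσ', AlgHom.commutes]
      · change σ' h (e x) = _
        rw [he, he, hσ', hkey, hz, AlgEquiv.one_apply, hσh]
    · -- `h_z`: the `F₁`-automorphism `z h`
      obtain ⟨τz, hτz⟩ := exists_algEquiv_restrict (F := F₁) (z h) (hzF h)
      let hz' : X ⟶ X := FinSubextCat.Hom.mk τz.toAlgHom
      have hσz : σ hz' = z h := AlgEquiv.ext fun x => by rw [hσ]; exact hτz x
      -- `α h_z = z h`: `z (h_z) ∈ {1, z h}` and `α h_z ≠ 1` by faithfulness of `Ψ^Base`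
      have hαz' : α hz' = z h := by
        rcases huniq h hz (z hz') (hzfix hz') with h1 | h1
        · rw [hαz hz', h1, mul_one, hσz, hcentral h hz s, mul_inv_cancel_right]
        · exfalso
          have hα1 : α hz' = 1 := by
            rw [hαz hz', h1, hσz, mul_assoc s (z h) (z h), hinvol h hz, mul_one, mul_inv_cancel]
          have hmap : ΨBase.map hz' = ΨBase.map (𝟙 X) := by
            refine FinSubextCat.hom_ext (AlgHom.ext fun y => ?_)
            rw [ΨBase.map_id]
            have hy := hα' hz' (e₁.symm y)
            rw [hα1, AlgEquiv.one_apply, RingEquiv.apply_symm_apply] at hy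
            exact hy.symm
          have hid : hz' = 𝟙 X := ΨBase.map_injective hmap
          apply hz
          refine AlgEquiv.ext fun x => ?_
          have hx := congrArg (fun k : X ⟶ X => k.toAlgHom x) hid
          rw [AlgEquiv.one_apply, ← hτz x]
          exact hx
      obtain ⟨τ₂, hτ₂⟩ := exists_algEquiv_rat_eq (F := F₂)
        ((ΨBase.map h).toAlgHom.comp (ΨBase.map hz').toAlgHom)
      refine ⟨AlgEquiv.ofRingEquiv (f := τ₂.toRingEquiv) fun b => ?_, fun x => ?_⟩
      · change τ₂ (algebraMap F₂ _ b) = _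
        rw [hτ₂, AlgHom.commutes]
      · change τ₂ (e x) = _
        have hzs : z h (s x) = s (z h x) := by
          have h1 := congrArg (fun g : X.L ≃ₐ[ℚ] X.L => g x) (hcentral h hz s)
          simp only [AlgEquiv.mul_apply] at h1
          exact h1.symm
        have hcomm1 : ∀ y, z h (σ h y) = σ h (z h y) := fun y => by
          have h1 := congrArg (fun g : X.L ≃ₐ[ℚ] X.L => g y) (hcentral h hz (σ h))
          simp only [AlgEquiv.mul_apply] at h1
          exact h1.symm
        have hzσz : z h (σ h (z h x)) = σ h x := by
          rw [hcomm1, ← AlgEquiv.mul_apply (z h) (z h), hinvol h hz, AlgEquiv.one_apply]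
        rw [he, he, hτ₂, AlgHom.comp_apply, ← hα' hz', hαz', hzs, hkey, hzσz, hσh]

end Arith

end Literature.AlgebraicGeometry.Frobenioids

end
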